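import Summits.KontsevichZagierPeriods.KontsevichZagierPeriods.Theses.TerasomaMultiplication
import Literature.NumberTheory.Transcendental.KZMellinFibres
import Literature.NumberTheory.Transcendental.KZSemiCanonicalReductionProofs
import Literature.NumberTheory.Transcendental.KZDominatedFamilyRelations
import Literature.NumberTheory.Transcendental.KZLogCalculusProofs

/-!
# `DuplicationAllExponents` (stmt-KontsevichZagierPeriods-12309, route TerasomaMultiplication)

The `n = 2` rung of the pure-Beta Gauss multiplication family, for EVERY rational exponent `s`:
the two Kontsevich–Zagier integral representations
`r = [(0,1), v^(-1/2) (1 - v)^(s-1)]` (value `B(1/2, s)`) and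
`r' = [(0,2), (σ(2 - σ))^(s-1)]` (value `2^(2s-1) B(s, s)`) are equivalent under the moves of the
KZ calculus (`KZ.relations`) — Legendre's duplication formula as a chain of moves
[Kontsevich–Zagier 2001, §1.2; Andrews–Askey–Roy 1999, Thm. 1.5.1].

The chain (Terasoma's covering is real at `n = 2`): with `D = (0,1) ⊆ ℝ¹` and the auxiliary
representations `A = [D, r.integrand(y²) · 2y]`, `B = [D, (1 - y²)^(s-1)]`,

* `[A] − [r]` is the Kummer move `v = y²` (`KZ.of_sub_of_mem_relations_of_boxDilation`);
* `[A] − [B] − [B]` is integrand additivity (`(y²)^(-1/2) · 2y = 2` on `D`);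
* `[B] − [r'|(0,1)]` is the fold `σ = 1 − y` (`KZ.of_sub_of_mem_relations_of_boxReflection`);
* `[B] − [T]` is the translation `σ = 1 + y` (`KZ.exists_translate`), and `[T] − [r'|(1,2)]` is a
  congruence (`KZ.of_sub_of_mem_relations_of_eqOn`), since `1 − y² = (1 + y)(1 − y)`;
* `[r'] − [r'|(0,1) ∪ (1,2)]` drops the null point `σ = 1`
  (`KZ.IntegralRep.of_sub_of_restrict_mem_relations`) and `[r'|(0,1) ∪ (1,2)] − [r'|(0,1)] − [r'|(1,2)]`
  is domain additivity.

No integrability estimate is needed: `B` inherits absolute convergence from `r'` along the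
measure-preserving translation, and `A = 2B` on `D`. Semialgebraicity of the auxiliary integrands
is `KZ.isSemialgebraicFunOn_mellinIntegrand` (family `1 − X₀²`, exponent `s − 1`). The hypothesis
`0 < s` of the item is not used (for `s ≤ 0` no such `r`, `r'` exist).
-/

noncomputable section

open Set MeasureTheory
open Literature.NumberTheory.Transcendental
open Literature.NumberTheory.Transcendental.KZ
open Literature.ModelTheory.ExponentialFields (IsSemialgebraic)
open MvPolynomial (X C aeval)

namespace Summit.KontsevichZagierPeriods.TerasomaMultiplication.DuplicationAllExponents

open Summit.KontsevichZagierPeriods.KontsevichZagierPeriods.Theses.TerasomaMultiplication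
  (DuplicationAllExponents)

/-! ## Bookkeeping in an abelian group -/

/-- The seven moves of the chain combine to `[r] − [r']`. [folklore] -/
theorem mem_of_chain {G : Type*} [AddCommGroup G] (H : AddSubgroup G) {r r' A B B₂ T B₁ U : G}
    (e1 : A - r ∈ H) (e2 : A - B - B ∈ H) (e3 : B - B₂ ∈ H) (e4 : B - T ∈ H) (e5 : T - B₁ ∈ H)
    (e6 : r' - U ∈ H) (e7 : U - B₂ - B₁ ∈ H) : r - r' ∈ H := by
  have key : r - r' = -(A - r) + (A - B - B) + (B - B₂) + (B - T) + (T - B₁) - (U - B₂ - B₁) -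
      (r' - U) := by abel
  rw [key]
  exact H.sub_mem (H.sub_mem (H.add_mem (H.add_mem (H.add_mem (H.add_mem (H.neg_mem e1) e2) e3)
    e4) e5) e7) e6

/-! ## Pointwise identities -/

/-- `(t²)^(-1/2) = t⁻¹` for `t > 0`. [folklore] -/
theorem sq_rpow_neg_half {t : ℝ} (ht : 0 < t) : (t ^ 2) ^ (-(1:ℝ) / 2) = t⁻¹ := by
  rw [← Real.rpow_two, ← Real.rpow_mul ht.le]
  have h : (2:ℝ) * (-(1:ℝ) / 2) = -1 := by norm_num
  rw [h, Real.rpow_neg_one]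

/-- The Kummer pull-back of the box integrand: `r.integrand(y²) · 2y = 2 (1 - y²)^(s-1)` on `(0,1)`.
[Kontsevich–Zagier 2001, §1.2 rule (2)] -/
theorem dil_eq {s : ℚ} {r : IntegralRep 1} (hr : r.domain = {x : Fin 1 → ℝ | x 0 ∈ Set.Ioo (0:ℝ) 1})
    (hi : EqOn r.integrand (fun x => (x 0) ^ (-(1:ℝ)/2) * (1 - x 0) ^ ((s:ℝ) - 1)) r.domain)
    {x : Fin 1 → ℝ} (hx : x ∈ {x : Fin 1 → ℝ | x 0 ∈ Set.Ioo (0:ℝ) 1}) :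
    r.integrand (boxDilation 0 1 x) * ((1 + 1 : ℕ) * x 0 ^ 1) = 2 * (1 - x 0 ^ 2) ^ ((s:ℝ) - 1) := by
  have hx0 : 0 < x 0 := hx.1
  have hmem : boxDilation 0 1 x ∈ r.domain := by
    rw [hr]
    show boxDilation 0 1 x 0 ∈ Ioo 0 1
    rw [boxDilation_apply_self]
    exact ⟨pow_pos hx0 _, pow_lt_one₀ hx0.le hx.2 (by norm_num)⟩
  rw [hi hmem]
  dsimp only
  rw [boxDilation_apply_self]
  simp only [Nat.reduceAdd, Nat.cast_ofNat, pow_one]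
  rw [sq_rpow_neg_half hx0]
  field_simp

/-- The fold: `(1 - y²)^(s-1) = r'.integrand(1 - y)` on `(0,1)`. [Kontsevich–Zagier 2001, §1.2 rule (2)] -/
theorem refl_eq {s : ℚ} {r' : IntegralRep 1} (hr' : r'.domain = {x | x 0 ∈ Set.Ioo (0:ℝ) 2})
    (hi' : EqOn r'.integrand (fun x => (x 0 * (2 - x 0)) ^ ((s:ℝ) - 1)) r'.domain)
    {x : Fin 1 → ℝ} (hx : x ∈ {x : Fin 1 → ℝ | x 0 ∈ Set.Ioo (0:ℝ) 1}) :
    (1 - x 0 ^ 2) ^ ((s:ℝ) - 1) = r'.integrand (boxReflection 0 x) := by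
  have hmem : boxReflection 0 x ∈ r'.domain := by
    rw [hr']
    show boxReflection 0 x 0 ∈ Ioo 0 2
    rw [boxReflection_apply_self]
    constructor <;> linarith [hx.1, hx.2]
  rw [hi' hmem]
  dsimp only
  rw [boxReflection_apply_self]
  congr 1
  ring

/-- The translation: `(1 - (σ-1)²)^(s-1) = r'.integrand σ` for `σ - 1 ∈ (0,1)`.
[Kontsevich–Zagier 2001, §1.2 rule (2)] -/
theorem transl_eq {s : ℚ} {r' : IntegralRep 1} (hr' : r'.domain = {x | x 0 ∈ Set.Ioo (0:ℝ) 2})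
    (hi' : EqOn r'.integrand (fun x => (x 0 * (2 - x 0)) ^ ((s:ℝ) - 1)) r'.domain)
    {x : Fin 1 → ℝ} (hx : x 0 - 1 ∈ Set.Ioo (0:ℝ) 1) :
    (1 - (x 0 - 1) ^ 2) ^ ((s:ℝ) - 1) = r'.integrand x := by
  have hmem : x ∈ r'.domain := by
    rw [hr']
    show x 0 ∈ Ioo 0 2
    constructor <;> linarith [hx.1, hx.2]
  rw [hi' hmem]
  dsimp only
  congr 1
  ring

/-! ## Admissibility of the auxiliary representations -/

/-- `(0,1) ⊆ ℝ¹` is Lebesgue measurable. [folklore] -/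
theorem measurableSet_D : MeasurableSet {x : Fin 1 → ℝ | x 0 ∈ Set.Ioo (0:ℝ) 1} :=
  measurableSet_Ioo.preimage (measurable_pi_apply 0)

/-- `x ↦ c (1 - x₀²)^(s-1)` (`c, s ∈ ℚ`) is a `ℚ`-semialgebraic function on every `ℚ`-semialgebraic
`D ⊆ (0,1)`: the Euler–Mellin integrand of the family `1 - X₀²` with exponent `s - 1`
(`KZ.isSemialgebraicFunOn_mellinIntegrand`). [Kontsevich–Zagier 2001, §1.1] -/
theorem isSemialgebraicFunOn_const_mul_rpow (c s : ℚ) {D : Set (Fin 1 → ℝ)}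
    (hD : IsSemialgebraic ℚ D) (hD1 : D ⊆ {x : Fin 1 → ℝ | x 0 ∈ Set.Ioo (0:ℝ) 1}) :
    IsSemialgebraicFunOn ℚ D (fun x => (c : ℝ) * (1 - x 0 ^ 2) ^ ((s : ℝ) - 1)) := by
  have hpos : ∀ x ∈ D, ∀ k : Fin 1,
      0 < aeval x ((fun _ : Fin 1 => (1 - X 0 ^ 2 : MvPolynomial (Fin 1) ℚ)) k) := by
    intro x hx k
    have h : x 0 ∈ Ioo (0:ℝ) 1 := hD1 hx
    simp only [map_sub, map_one, map_pow, MvPolynomial.aeval_X]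
    have : x 0 ^ 2 < 1 := pow_lt_one₀ h.1.le h.2 two_ne_zero
    linarith
  refine (isSemialgebraicFunOn_mellinIntegrand hD
    (fun _ : Fin 1 => (1 - X 0 ^ 2 : MvPolynomial (Fin 1) ℚ)) (fun _ => s - 1) c hpos).congr
    fun x _ => ?_
  simp [mellinIntegrand]

/-- The fold integrand `(1 - y²)^(s-1)` is absolutely integrable on `(0,1)`: it is the translate by
`1` of `r'.integrand` restricted to `(1,2)`, and translations preserve Lebesgue measure.
[Kontsevich–Zagier 2001, §1.2] -/
theorem integrableOn_fold {s : ℚ} {r' : IntegralRep 1} (hr' : r'.domain = {x | x 0 ∈ Set.Ioo (0:ℝ) 2})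
    (hi' : EqOn r'.integrand (fun x => (x 0 * (2 - x 0)) ^ ((s:ℝ) - 1)) r'.domain) :
    IntegrableOn (fun x : Fin 1 → ℝ => (1 - x 0 ^ 2) ^ ((s:ℝ) - 1)) {x : Fin 1 → ℝ | x 0 ∈ Set.Ioo (0:ℝ) 1} := by
  have hsub : {x : Fin 1 → ℝ | x 0 ∈ Ioo (1:ℝ) 2} ⊆ r'.domain := by
    rw [hr']
    intro x hx
    exact ⟨zero_lt_one.trans hx.1, hx.2⟩
  have h1 : IntegrableOn r'.integrand {x : Fin 1 → ℝ | x 0 ∈ Ioo (1:ℝ) 2} :=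
    r'.integrableOn.mono_set hsub
  have h2 : IntegrableOn (fun x => r'.integrand (x + fun _ => (1:ℝ)))
      ((fun x => x + fun _ => (1:ℝ)) ⁻¹' {x : Fin 1 → ℝ | x 0 ∈ Ioo (1:ℝ) 2}) :=
    ((measurePreserving_add_right volume (fun _ : Fin 1 => (1:ℝ))).integrableOn_comp_preimage
      (measurableEmbedding_addRight _)).mpr h1
  have hpre : ((fun x => x + fun _ => (1:ℝ)) ⁻¹' {x : Fin 1 → ℝ | x 0 ∈ Ioo (1:ℝ) 2}) = {x : Fin 1 → ℝ | x 0 ∈ Set.Ioo (0:ℝ) 1} := by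
    ext x
    simp only [mem_preimage, mem_setOf_eq, Pi.add_apply, mem_Ioo]
    constructor <;> rintro ⟨h1, h2⟩ <;> constructor <;> linarith
  rw [hpre] at h2
  refine h2.congr_fun (fun x hx => ?_) measurableSet_D
  have hx' : ((x + fun _ => (1:ℝ)) : Fin 1 → ℝ) 0 - 1 ∈ Ioo (0:ℝ) 1 := by
    have h : x 0 ∈ Ioo (0:ℝ) 1 := hx
    simpa using h
  show r'.integrand (x + fun _ => (1:ℝ)) = (1 - x 0 ^ 2) ^ ((s:ℝ) - 1)
  rw [← transl_eq hr' hi' hx']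
  simp

/-! ## Geometry of the three changes of variables on `(0,1)` -/

/-- The Kummer map `y ↦ y²` maps `(0,1)` onto `(0,1)`. [folklore] -/
theorem image_boxDilation_D : boxDilation (0 : Fin 1) 1 '' {x : Fin 1 → ℝ | x 0 ∈ Set.Ioo (0:ℝ) 1} = {x : Fin 1 → ℝ | x 0 ∈ Set.Ioo (0:ℝ) 1} := by
  ext y
  constructor
  · rintro ⟨x, hx, rfl⟩
    have hx' : x 0 ∈ Ioo (0:ℝ) 1 := hx
    show boxDilation 0 1 x 0 ∈ Ioo 0 1
    rw [boxDilation_apply_self]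
    exact ⟨pow_pos hx'.1 _, pow_lt_one₀ hx'.1.le hx'.2 (by norm_num)⟩
  · intro hy
    have hy' : y 0 ∈ Ioo (0:ℝ) 1 := hy
    refine ⟨fun _ => Real.sqrt (y 0), ?_, ?_⟩
    · show Real.sqrt (y 0) ∈ Ioo 0 1
      refine ⟨Real.sqrt_pos.2 hy'.1, ?_⟩
      calc Real.sqrt (y 0) < Real.sqrt 1 := Real.sqrt_lt_sqrt hy'.1.le hy'.2
        _ = 1 := Real.sqrt_one
    · funext i
      have hi : i = 0 := Subsingleton.elim _ _
      subst hi
      rw [boxDilation_apply_self]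
      simp [Real.sq_sqrt hy'.1.le]

/-- The fold `y ↦ 1 - y` maps `(0,1)` onto `(0,1)`. [folklore] -/
theorem preimage_boxReflection_D : boxReflection (0 : Fin 1) ⁻¹' {x : Fin 1 → ℝ | x 0 ∈ Set.Ioo (0:ℝ) 1} = {x : Fin 1 → ℝ | x 0 ∈ Set.Ioo (0:ℝ) 1} := by
  ext x
  simp only [mem_preimage, mem_setOf_eq, boxReflection_apply_self, mem_Ioo]
  constructor <;> rintro ⟨h1, h2⟩ <;> constructor <;> linarith

/-! ## The theorem -/

/-- **Legendre duplication for every rational exponent is a chain of Kontsevich–Zagier moves**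
(item `DuplicationAllExponents`, stmt-KontsevichZagierPeriods-12309): for `s ∈ ℚ` and
representations `r = [(0,1), v^(-1/2)(1-v)^(s-1)]`, `r' = [(0,2), (σ(2-σ))^(s-1)]`,
`[r] − [r'] ∈ KZ.relations`. Moves: `v = y²` (Kummer), integrand additivity `A = B + B`, the fold
`σ = 1 − y`, the translation `σ = 1 + y`, and domain additivity at the null point `σ = 1`.
[Kontsevich–Zagier 2001, §1.2; Andrews–Askey–Roy 1999, Thm. 1.5.1] -/
theorem duplicationAllExponents_proof : DuplicationAllExponents := by
  intro s _ r r' hr hi hr' hi'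
  change of r - of r' ∈ relations
  have hD : IsSemialgebraic ℚ {x : Fin 1 → ℝ | x 0 ∈ Set.Ioo (0:ℝ) 1} := hr ▸ r.isSemialgebraic_domain
  -- the fold representation `B = [D, (1 - y²)^(s-1)]`
  have hb_sa : IsSemialgebraicFunOn ℚ {x : Fin 1 → ℝ | x 0 ∈ Set.Ioo (0:ℝ) 1} (fun x => (1 - x 0 ^ 2) ^ ((s:ℝ) - 1)) :=
    (isSemialgebraicFunOn_const_mul_rpow 1 s hD subset_rfl).congr fun x _ => by simp
  have hb_int := integrableOn_fold hr' hi'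
  obtain ⟨B, hBd, hBi⟩ : ∃ B : IntegralRep 1,
      B.domain = {x : Fin 1 → ℝ | x 0 ∈ Set.Ioo (0:ℝ) 1} ∧ B.integrand = fun x => (1 - x 0 ^ 2) ^ ((s:ℝ) - 1) :=
    ⟨⟨_, _, hD, hb_sa, hb_int⟩, rfl, rfl⟩
  -- the Kummer pull-back `A = [D, r.integrand(y²) · 2y]`
  have ha_eq : ∀ x ∈ {x : Fin 1 → ℝ | x 0 ∈ Set.Ioo (0:ℝ) 1}, r.integrand (boxDilation 0 1 x) * ((1 + 1 : ℕ) * x 0 ^ 1) =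
      2 * (1 - x 0 ^ 2) ^ ((s:ℝ) - 1) := fun x hx => dil_eq hr hi hx
  have ha_sa : IsSemialgebraicFunOn ℚ {x : Fin 1 → ℝ | x 0 ∈ Set.Ioo (0:ℝ) 1}
      (fun x => r.integrand (boxDilation 0 1 x) * ((1 + 1 : ℕ) * x 0 ^ 1)) := by
    refine (isSemialgebraicFunOn_const_mul_rpow 2 s hD subset_rfl).congr fun x hx => ?_
    show ((2:ℚ) : ℝ) * (1 - x 0 ^ 2) ^ ((s:ℝ) - 1) = r.integrand (boxDilation 0 1 x) * ((1 + 1 : ℕ) * x 0 ^ 1)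
    rw [ha_eq x hx]
    push_cast
    rfl
  have ha_int : IntegrableOn
      (fun x => r.integrand (boxDilation 0 1 x) * ((1 + 1 : ℕ) * x 0 ^ 1)) {x : Fin 1 → ℝ | x 0 ∈ Set.Ioo (0:ℝ) 1} := by
    have h2 : IntegrableOn (fun x : Fin 1 → ℝ => (2:ℝ) * (1 - x 0 ^ 2) ^ ((s:ℝ) - 1)) {x : Fin 1 → ℝ | x 0 ∈ Set.Ioo (0:ℝ) 1} :=
      hb_int.integrable.const_mul 2
    exact h2.congr_fun (fun x hx => (ha_eq x hx).symm) measurableSet_D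
  obtain ⟨A, hAd, hAi⟩ : ∃ A : IntegralRep 1, A.domain = {x : Fin 1 → ℝ | x 0 ∈ Set.Ioo (0:ℝ) 1} ∧
      A.integrand = fun x => r.integrand (boxDilation 0 1 x) * ((1 + 1 : ℕ) * x 0 ^ 1) :=
    ⟨⟨_, _, hD, ha_sa, ha_int⟩, rfl, rfl⟩
  -- move 1 (Kummer `v = y²`): `[A] − [r]`
  have e1 : of A - of r ∈ relations := by
    refine of_sub_of_mem_relations_of_boxDilation 0 1 (fun x hx => ?_) ?_ (fun x hx => ?_)
    · rw [hAd] at hx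
      exact hx.1
    · rw [hr, hAd, image_boxDilation_D]
    · rw [hAi]
  -- move 2 (integrand additivity): `[A] − [B] − [B]`
  have e2 : of A - of B - of B ∈ relations := by
    refine integrandAddRel_subset_relations
      ⟨1, A, B, B, hBd.trans hAd.symm, hBd.trans hAd.symm, fun x hx => ?_, rfl⟩
    rw [hAd] at hx
    simp only [hAi, hBi, Pi.add_apply]
    rw [ha_eq x hx, two_mul]
  -- move 3 (fold `σ = 1 − y`): `[B] − [r'|(0,1)]`
  have hsub₁ : {x : Fin 1 → ℝ | x 0 ∈ Set.Ioo (0:ℝ) 1} ⊆ r'.domain := by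
    rw [hr']
    exact fun x hx => ⟨hx.1, hx.2.trans one_lt_two⟩
  have e3 : of B - of (r'.restrict {x : Fin 1 → ℝ | x 0 ∈ Set.Ioo (0:ℝ) 1} hD hsub₁) ∈ relations := by
    refine of_sub_of_mem_relations_of_boxReflection 0 ?_ (fun x hx => ?_)
    · rw [hBd, IntegralRep.domain_restrict, preimage_boxReflection_D]
    · rw [hBd] at hx
      rw [hBi, IntegralRep.integrand_restrict]
      exact refl_eq hr' hi' hx
  -- move 4 (translation `σ = 1 + y`): `[B] − [T]`, and the congruence `[T] − [r'|(1,2)]`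
  obtain ⟨T, hTd, hTi, e4⟩ := exists_translate B (fun _ => (1:ℚ))
  have hTmem : ∀ x, x ∈ T.domain ↔ x 0 - 1 ∈ Ioo (0:ℝ) 1 := by
    intro x
    rw [hTd, hBd]
    simp
  have hsub₃ : T.domain ⊆ r'.domain := by
    intro x hx
    rw [hTmem x] at hx
    rw [hr']
    exact ⟨by linarith [hx.1], by linarith [hx.2]⟩
  have e5 : of T - of (r'.restrict T.domain T.isSemialgebraic_domain hsub₃) ∈ relations := by
    refine of_sub_of_mem_relations_of_eqOn rfl (fun x hx => ?_)
    have hx' := (hTmem x).1 hx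
    rw [IntegralRep.integrand_restrict, hTi, hBi]
    dsimp only
    rw [← transl_eq hr' hi' hx']
    simp
  -- move 5 (domain additivity at the null point `σ = 1`)
  have hU : IsSemialgebraic ℚ ({x : Fin 1 → ℝ | x 0 ∈ Set.Ioo (0:ℝ) 1} ∪ T.domain) := hD.union T.isSemialgebraic_domain
  have hUsub : {x : Fin 1 → ℝ | x 0 ∈ Set.Ioo (0:ℝ) 1} ∪ T.domain ⊆ r'.domain := union_subset hsub₁ hsub₃
  have e6 : of r' - of (r'.restrict _ hU hUsub) ∈ relations := by
    refine r'.of_sub_of_restrict_mem_relations hU hUsub ?_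
    have hnull : volume (Icc (fun _ : Fin 1 => (1:ℝ)) (fun _ => 1)) = 0 := by
      rw [Real.volume_Icc_pi]
      simp
    have hsubset : r'.domain \ ({x : Fin 1 → ℝ | x 0 ∈ Set.Ioo (0:ℝ) 1} ∪ T.domain) ⊆ Icc (fun _ : Fin 1 => (1:ℝ)) (fun _ => 1) := by
      rintro x ⟨hx1, hx2⟩
      rw [hr'] at hx1
      have hx1' : x 0 ∈ Ioo (0:ℝ) 2 := hx1
      rw [mem_union, hTmem x, not_or] at hx2
      have h1 : x 0 = 1 := by
        rcases lt_trichotomy (x 0) 1 with h | h | h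
        · exact absurd (show x ∈ {x : Fin 1 → ℝ | x 0 ∈ Set.Ioo (0:ℝ) 1} from ⟨hx1'.1, h⟩) hx2.1
        · exact h
        · exact absurd (show x 0 - 1 ∈ Ioo (0:ℝ) 1 from ⟨by linarith, by linarith [hx1'.2]⟩) hx2.2
      have hxi : ∀ i : Fin 1, x i = 1 := fun i => by rw [Subsingleton.elim i 0, h1]
      exact ⟨fun i => (hxi i).ge, fun i => (hxi i).le⟩
    exact measure_mono_null hsubset hnull
  have e7 : of (r'.restrict _ hU hUsub) - of (r'.restrict {x : Fin 1 → ℝ | x 0 ∈ Set.Ioo (0:ℝ) 1} hD hsub₁) -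
      of (r'.restrict T.domain T.isSemialgebraic_domain hsub₃) ∈ relations := by
    refine domainAddRel_subset_relations
      ⟨1, r'.restrict _ hU hUsub, r'.restrict _ hD hsub₁,
        r'.restrict T.domain T.isSemialgebraic_domain hsub₃, rfl, ?_, fun _ _ => rfl,
        fun _ _ => rfl, rfl⟩
    simp only [IntegralRep.domain_restrict]
    have hempty : ({x : Fin 1 → ℝ | x 0 ∈ Set.Ioo (0:ℝ) 1} ∩ T.domain) = ∅ := by
      rw [Set.eq_empty_iff_forall_notMem]
      rintro x ⟨h1, h2⟩
      have h1' : x 0 ∈ Ioo (0:ℝ) 1 := h1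
      have h2' := (hTmem x).1 h2
      linarith [h1'.2, h2'.1]
    rw [hempty, measure_empty]
  -- assemble
  exact mem_of_chain relations e1 e2 e3 (changeOfVariablesRel_subset_relations e4) e5 e6 e7

end Summit.KontsevichZagierPeriods.TerasomaMultiplication.DuplicationAllExponents

end
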